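/-
Copyright (c) 2026 the pub-hodgecm-mathlib formalisation cell (harness21).  Prover seat hodgecm-mathlib-LH1-p01 (g12) on the N8-INNER road (row 2 `stub_N8`, road owner
LH2-plan (g1), DEAL #1 brick (5) «J′-TRANSPORT»), FILE B: the pins and the two-frame agreement head; 2026-09-02.
-/
import Literature.NumberTheory.Rogawski1990.ArchOrbFamGExtJumpSideGNondeg   -- (this seat) FILE A: `orbFamGExt_jumpGSideStatement_of_ne_zero` (the jumping test function with non-zero Cayley value, nondegenerate frame)
import Literature.NumberTheory.Rogawski1990.ArchJumpBricksOfSides           -- ★ (LH4-p03 (g4)): `exists_hcSemireg_zero_two`, `mem_splitChartPlaces_of_isIndefiniteAt`; brings ★ `ArchJumpAgreementOfBricks` (`jc'_eq_of_hasOneSidedJump`, `slotSign_zero_ne_slotSign_two`)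
import Literature.NumberTheory.Rogawski1990.ArchOrbFamGExtJumpOrderZero      -- ★ (LH5-p04 (g3)): the symmetry kit `hasOneSidedJump_pair_swap`, `hcCayPt_swap`, `HcSemireg.pair_swap`, `hasOneSidedJump_wall_one_two_of_zero_two`, `HcSemireg.hcSwapAt_zero_one`, `hcCayPt_one_two_eq_hcCayPt_zero_two_hcSwapAt`, `noncompactPair_cases`
import Literature.NumberTheory.Rogawski1990.ArchHCOrbitalFamiliesNondeg      -- ★ p851672 (LH10-p02 (g8)) CUT B head: `exists_jc_archHCSpaceG_orbFamGExt_of_ne_zero`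
import HarnessLib

/-!
# (5) «J′-TRANSPORT»: the (I₃) jump constants of the `α`-atlas and of the `β`-atlas AGREE at every common covered wall — any two jump data valid for all test functions on two
# nondegenerate real diagonal frames over the same CM field coincide on the noncompact pairs (Harish-Chandra's jump relations; Shelstad 1979 §4; Bouaziz 1994 §3.2 (I₃))

Topic `NumberTheory/Rogawski1990`; namespace `Literature.NumberTheory.Rogawski1990`.  THEOREMS ONLY (no definition, no instance, no notation, no axiom, no named fact, no `sorry`);
kernel lane `--kind proof --supports stmt-HodgeConjecture-24833`.  Cell `pub/hodgecm-mathlib`, crux H413 = `stmt-HodgeConjecture-24833`; N8-INNER road (LEAD F0P3a-plan (g15)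
T14-4 «§4 YES»; N8 ROAD CENSUS v0 (F0P3a-p02 (g22)) §2 row «JUMP CONSTANTS AGREE across the twist», §5 (5)), road owner LH2-plan (g1) DEAL #1 2026-09-02T15:34:48Z, brick
**(5) «J′-TRANSPORT»**, FILE B of two (FILE A = `ArchOrbFamGExtJumpSideGNondeg`).  Author LH1-p01 (g12).

THE MATHEMATICS.  On the anisotropic inner form `G′_∞ = U(diag α)(L⁺ ⊗ ℝ)` and on the quasi-split `G_∞ = U(Φ₃)(L⁺ ⊗ ℝ)` read in its ISOTROPIC diagonal frame `β = (½, 1, −½)`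
(★ `formCongr_quasiSplitFrame_diagonal`) alike, the letter L1 (CUT B ★ `exists_jc_archHCSpaceG_orbFamGExt_of_ne_zero`) gives a jump datum `jc′` with EVERY extended orbital family
`orbFamGExt ν a` in `ArchHCSpaceG (slotSign) jc′`.  The datum is an `∃`-witness, but RIGID where it is read: at a covered noncompact wall `(S, w, 0, 2)` ONE test function with
non-zero Cayley value pins `jc′ S w 0 2` (★ `jc'_eq_of_hasOneSidedJump`), and FILE A (the `hα`-twin of the organ-J side head ★ `orbFamGExt_jumpGSideStatement`) exhibits it with
the jump constant the CLOSED LITERAL `i·C₁∕C₂` of the SHARED standard rank-one datum `(U(J), μ₀, μ₀′, C₁, C₂)` (★ `sharedRankOneDatum_exists`) — a literal that sees neither the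
frame nor the Haar measure, chart or wall.  The other noncompact pairs follow by the symmetry kit of ★ `ArchOrbFamGExtJumpOrderZero` (`(2,0)`, `(2,1)`: reversed normal; `(1,2)`:
the realised reflection `(0 1)`, ★ `archHcWeyl_orbFamGExt`): `jc′ S w i j = ε i j · (i·C₁∕C₂)` (`ε 0 2 = ε 2 1 = 1`, `ε 2 0 = ε 1 2 = −1`) for EVERY valid datum on EVERY nondegenerate
frame; so two valid data on `α₁, α₂` over the same `L` AGREE at every wall covered for both.  No Haar push-forward, no `unitaryGroupOfFormCongr` (the descent constant cancels,
★ `ArchOrbFamGExtJumpWall02` l. 32) — those stay with READ-G.  At `α`-definite places and on non-`α`-admissible charts nothing is claimed (★ `ArchHcJump` never reads there).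
* §1 `hcSemireg_one_two_hcSwapAt_zero_one` (a `(1,2)`-semiregular point from a `(0,2)` one).  §2 **`archHcJump_const_table_of_sharedDatum`**: frame nondegenerate, the shared
  datum (★ binder block VERBATIM), a valid `jc′`, `S` admissible, `w` covered ⊢ the four literal pins.  §3 **`archHcJump_const_table`** (datum-free), **`archHcJump_const_eq_sign_mul`**
  (`jc′ S w i j = ε i j · jc′ S w 0 2`).  §4 guards: `isIndefiniteAt_of_mem_splitChartPlaces`, `isCoveredWall_of_mem_splitChartPlaces`, `slotSign_ne_iff_of_mem_splitChartPlaces`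
  (noncompact pairs = pairs meeting slot `2` — the same for every frame).  §5 **HEAD `archHcJump_const_eq_of_innerForms`** (+ `…_of_mem_splitChartPlaces`, the
  FORWARD brick's binder shape): two frames, valid data, common covered noncompact wall ⊢ `jc₁ S w i j = jc₂ S w i j`; **`exists_archHCSpaceG_const_eq_of_innerForms`**: a valid
  `jc₂` on `α₂` (CUT B) agreeing with a given valid `jc₁` on `α₁`.
HONEST LABEL: HC_CM is proved only modulo the 7 printed citations (2 remaining: hLiu418 = `stmt-HodgeConjecture-24832`, h413 = `stmt-HodgeConjecture-24833`) until rung 0 closes;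
count-neutral (no leaf, no letter, no books row moves; row 2 stays PRINT until (Sh)′ is ★ and ED. 43 re-keys 27456).

## References
* [Shelstad1979] D. Shelstad, *Characters and inner forms of a quasi-split group over ℝ*, Compositio Math. 39 (1979), §4 pp. 20–25, Lemma 4.3 p. 25, Prop. 4.5 p. 26, Thm. 4.7 (IIIb) p. 31.
* [Bouaziz1994IntegralesOrbitales] A. Bouaziz, *Intégrales orbitales sur les groupes de Lie réductifs*, Ann. Sci. ÉNS (4) 27 (1994), §3.2 (I₃) p. 580, Thm. 3.2.1 p. 581, Rem. 2 p. 594.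
* [Rogawski1990] J. D. Rogawski, *Automorphic Representations of Unitary Groups in Three Variables*, Ann. of Math. Stud. 123 (1990), §3.6 p. 28; §8.2 Prop. 8.2.1 (c) p. 119, pp. 122–124; §14.2 (14.2.1) pp. 232–233.
* [Varadarajan1989] V. S. Varadarajan, *An Introduction to Harmonic Analysis on Semisimple Lie Groups* (1989), §6.4 Thm 23.
-/

set_option autoImplicit false

noncomputable section

open MeasureTheory MeasureTheory.Measure NumberField NumberField.InfinitePlace Matrix Complex Set Filter Topology
open scoped MatrixGroups Matrix Real Classical ENNReal NNReal ContDiff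
open Literature.NumberTheory.Automorphic Literature.NumberTheory.Automorphic.UnitaryGroup Literature.NumberTheory.Automorphic.ArchCartan
open Literature.NumberTheory.Automorphic.Shelstad1979.StableOrbitalIntegrals
open Literature.NumberTheory.GaloisRepresentations Literature.MeasureTheory.Group

namespace Literature.NumberTheory.Rogawski1990

/-! ## §1 A `(1,2)`-semiregular point from a `(0,2)`-semiregular one -/

section Points

variable {W : Type*} [DecidableEq W]

/-- **The realised compact reflection `σ = (0 1)` carries a semiregular point of the wall `(0,2)` to a semiregular point of the wall `(1,2)`** (converse of ★
`HcSemireg.hcSwapAt_zero_one`; the third eigenvalue and the other places are untouched). [cite: Shelstad1979, §4 p. 22; property (II) p. 23] -/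
theorem hcSemireg_one_two_hcSwapAt_zero_one {S : Finset W} {w : W} (hw : w ∉ S) {s : W → Fin 3 → ℝ} (hs : HcSemireg S w 0 2 s) :
    HcSemireg S w 1 2 (hcSwapAt w 0 1 s) := by
  obtain ⟨h02, h3, hreg, hsplit⟩ := hs
  refine ⟨?_, ?_, fun w' hw' hne => ?_, fun w' hw' => ?_⟩
  · rw [(hcSwapAt_apply_pair w 0 1 s).2, hcSwapAt_apply_self_of_ne w (show (2 : Fin 3) ≠ 0 by decide) (show (2 : Fin 3) ≠ 1 by decide)]
    exact h02
  · rw [hcThird_one_two, (hcSwapAt_apply_pair w 0 1 s).1, (hcSwapAt_apply_pair w 0 1 s).2]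
    rw [hcThird_zero_two] at h3
    exact h3
  · simp only [hcSwapAt_apply_of_ne hne]
    exact hreg w' hw' hne
  · rw [hcSwapAt_apply_of_ne (ne_of_mem_of_not_mem hw' hw)]
    exact hsplit w' hw'

end Points
/-! ## §2 The four pins of a valid jump datum at a covered wall, WITH the shared literal `i·C₁∕C₂` -/

/-- **THE JUMP-CONSTANT TABLE OF A VALID DATUM, LITERAL FORM.**  Frame `(L, diag α, ν′)` real, `α_i ≠ 0` (anisotropy NOT assumed); the SHARED standard rank-one datum
`(U(J), μ₀, μ₀′, C₁, C₂)` with its (K0±)∕(A0)∕link texts (★ binder block VERBATIM).  If `jc′` is VALID FOR ALL TEST FUNCTIONS (`orbFamGExt ν′ a′ ∈ ArchHCSpaceG (slotSign L α) jc′`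
for every `a′`), then at every admissible `S` and covered `w`: `jc′ S w 0 2 = i·C₁∕C₂`, `jc′ S w 2 0 = −i·C₁∕C₂`, `jc′ S w 1 2 = −i·C₁∕C₂`, `jc′ S w 2 1 = i·C₁∕C₂` — FILE A's
test function pins `(0,2)` (★ `jc'_eq_of_hasOneSidedJump`); `(2,0)`, `(2,1)` by the reversed normal (★ `hasOneSidedJump_pair_swap`); `(1,2)` at `σs` by the realised reflection
`σ = (0 1)` (★ `archHcWeyl_orbFamGExt`, ★ `hasOneSidedJump_wall_one_two_of_zero_two`).
[cite: Shelstad1979, Prop. 4.5 (p. 26); Thm. 4.7 (IIIb) (p. 31)] [cite: Bouaziz1994IntegralesOrbitales, §3.2 (I₃) p. 580; Rem. 2 p. 594] [cite: Rogawski1990, §8.2 Prop. 8.2.1 (c) p. 119] -/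
theorem archHcJump_const_table_of_sharedDatum :
  ∀ (L : Type) [Field L] [NumberField L] [IsCMField L] (α : Fin 3 → L)
    [MeasurableSpace (↥(arch (↥(maximalRealSubfield L)) L (IsCMField.complexConj L) 3 (Matrix.diagonal α)))] [BorelSpace (↥(arch (↥(maximalRealSubfield L)) L (IsCMField.complexConj L) 3 (Matrix.diagonal α)))]
    (ν' : Measure (↥(arch (↥(maximalRealSubfield L)) L (IsCMField.complexConj L) 3 (Matrix.diagonal α)))) [ν'.IsHaarMeasure] [ν'.IsMulRightInvariant],
    ((Matrix.diagonal α).map (cmConjRingHom L)).transpose = Matrix.diagonal α →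
    (∀ i, α i ≠ 0) →
    ∀ {J : Matrix (Fin 2) (Fin 2) ℂ} (hJ : J = (StdForm.antidiagonal 2).over ℂ)
      [MeasurableSpace ↥(unitaryGroupOfForm (starRingEnd ℂ) J)] [BorelSpace ↥(unitaryGroupOfForm (starRingEnd ℂ) J)]
      [LocallyCompactSpace ↥(unitaryGroupOfForm (starRingEnd ℂ) J)] [SecondCountableTopology ↥(unitaryGroupOfForm (starRingEnd ℂ) J)]
      [MeasurableSpace (↥(unitaryGroupOfForm (starRingEnd ℂ) J) ⧸ torusU (starRingEnd ℂ) J)] [BorelSpace (↥(unitaryGroupOfForm (starRingEnd ℂ) J) ⧸ torusU (starRingEnd ℂ) J)]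
      (μ₀ : Measure ↥(unitaryGroupOfForm (starRingEnd ℂ) J)) [μ₀.IsHaarMeasure] [μ₀.IsMulRightInvariant]
      (μ₀' : Measure (↥(unitaryGroupOfForm (starRingEnd ℂ) J) ⧸ torusU (starRingEnd ℂ) J)) [SMulInvariantMeasure ↥(unitaryGroupOfForm (starRingEnd ℂ) J) (↥(unitaryGroupOfForm (starRingEnd ℂ) J) ⧸ torusU (starRingEnd ℂ) J) μ₀'] [IsFiniteMeasureOnCompacts μ₀']
      (C₁ C₂ : ℝ), 0 < C₁ → 0 < C₂ →
      (∀ (f : Matrix (Fin 2) (Fin 2) ℂ → ℂ), Continuous f → HasCompactSupport f → ∀ z : Circle,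
        HasOneSidedJump (fun ψ : ℝ => (2 * Real.sin ψ : ℂ) *
            ∫ h : ↥(unitaryGroupOfForm (starRingEnd ℂ) J),
              f (((h * ⟨Matrix.GeneralLinearGroup.mkOfDetNeZero !![(1 : ℂ), 1; 1, -1] det_cayleyTwo_ne_zero *
                    circleDiagonal 2 ![z * Circle.exp ψ, z * Circle.exp (-ψ)] *
                    (Matrix.GeneralLinearGroup.mkOfDetNeZero !![(1 : ℂ), 1; 1, -1] det_cayleyTwo_ne_zero)⁻¹,
                  cayley_conj_circleDiagonal_mem_of_eq_over hJ _⟩ * h⁻¹ :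
                ↥(unitaryGroupOfForm (starRingEnd ℂ) J)) : GL (Fin 2) ℂ) : Matrix (Fin 2) (Fin 2) ℂ) ∂μ₀)
          ((C₁ : ℂ) * ((∫ p in Ioi (0 : ℝ) ×ˢ Ioc (0 : ℝ) (2 * π),
              f ((!![(1 : ℂ), 1; 1, -1] : Matrix (Fin 2) (Fin 2) ℂ) *
                ((z : ℂ) • (1 : Matrix (Fin 2) (Fin 2) ℂ) + p.1 • Matrix.diagonal ![(z : ℂ) * I, -((z : ℂ) * I)] +
                  p.1 • !![(0 : ℂ), -((z : ℂ) * I) * cexp (-((p.2 : ℂ) * I)); ((z : ℂ) * I) * cexp ((p.2 : ℂ) * I), 0]) *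
                !![(1 / 2 : ℂ), 1 / 2; 1 / 2, -(1 / 2)])) +
            ∫ p in Ioi (0 : ℝ) ×ˢ Ioc (0 : ℝ) (2 * π),
              f ((!![(1 : ℂ), 1; 1, -1] : Matrix (Fin 2) (Fin 2) ℂ) *
                ((z : ℂ) • (1 : Matrix (Fin 2) (Fin 2) ℂ) + p.1 • Matrix.diagonal ![-((z : ℂ) * I), (z : ℂ) * I] +
                  p.1 • !![(0 : ℂ), ((z : ℂ) * I) * cexp (-((p.2 : ℂ) * I)); -((z : ℂ) * I) * cexp ((p.2 : ℂ) * I), 0]) *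
                !![(1 / 2 : ℂ), 1 / 2; 1 / 2, -(1 / 2)])))) →
      (∀ (f : Matrix (Fin 2) (Fin 2) ℂ → ℂ), Continuous f → HasCompactSupport f → ∀ θ : ℝ,
      Tendsto (fun x : ℝ => |Real.exp x - Real.exp (-x)| •
          ∫ y, descConj (⟨hypBlockGL x θ, hypBlockGL_mem_of_eq_over hJ x θ⟩ : ↥(unitaryGroupOfForm (starRingEnd ℂ) J)) (torusU (starRingEnd ℂ) J)
            (LineRing.forall_mem_torusU_comm (starRingEnd ℂ) J (hypBlockGL_mem_torusU hJ x θ))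
            (fun g : ↥(unitaryGroupOfForm (starRingEnd ℂ) J) => f ((g : GL (Fin 2) ℂ) : Matrix (Fin 2) (Fin 2) ℂ)) y ∂μ₀')
        (𝓝[≠] 0)
        (𝓝 (C₂ • ((∫ p in Ioi (0 : ℝ) ×ˢ Ioc (0 : ℝ) (2 * π),
            f ((!![(1 : ℂ), 1; 1, -1] : Matrix (Fin 2) (Fin 2) ℂ) *
              (Complex.exp ((θ : ℂ) * Complex.I) • (1 : Matrix (Fin 2) (Fin 2) ℂ) +
                p.1 • Matrix.diagonal ![Complex.exp ((θ : ℂ) * Complex.I) * Complex.I, -(Complex.exp ((θ : ℂ) * Complex.I) * Complex.I)] +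
                p.1 • !![(0 : ℂ), -(Complex.exp ((θ : ℂ) * Complex.I) * Complex.I) * Complex.exp (-((p.2 : ℂ) * Complex.I));
                  (Complex.exp ((θ : ℂ) * Complex.I) * Complex.I) * Complex.exp ((p.2 : ℂ) * Complex.I), 0]) *
              !![(1 / 2 : ℂ), 1 / 2; 1 / 2, -(1 / 2)])) +
          ∫ p in Ioi (0 : ℝ) ×ˢ Ioc (0 : ℝ) (2 * π),
            f ((!![(1 : ℂ), 1; 1, -1] : Matrix (Fin 2) (Fin 2) ℂ) *
              (Complex.exp ((θ : ℂ) * Complex.I) • (1 : Matrix (Fin 2) (Fin 2) ℂ) +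
                p.1 • Matrix.diagonal ![-(Complex.exp ((θ : ℂ) * Complex.I) * Complex.I), Complex.exp ((θ : ℂ) * Complex.I) * Complex.I] +
                p.1 • !![(0 : ℂ), (Complex.exp ((θ : ℂ) * Complex.I) * Complex.I) * Complex.exp (-((p.2 : ℂ) * Complex.I));
                  -(Complex.exp ((θ : ℂ) * Complex.I) * Complex.I) * Complex.exp ((p.2 : ℂ) * Complex.I), 0]) *
              !![(1 / 2 : ℂ), 1 / 2; 1 / 2, -(1 / 2)]))))) →
      (∀ (ρ : Measure ↥(torusU (starRingEnd ℂ) J)) [ρ.IsHaarMeasure] [ρ.IsInvInvariant],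
    μ₀' = ρ ((fun p : ℝ × ℝ =>
        (⟨⟨hypBlockGL p.1 p.2, hypBlockGL_mem_of_eq_over hJ p.1 p.2⟩, hypBlockGL_mem_torusU hJ p.1 p.2⟩ : ↥(torusU (starRingEnd ℂ) J))) ''
          (Set.Icc (0 : ℝ) 1 ×ˢ Set.Icc (0 : ℝ) (2 * π))) •
      quotientMeasure (torusU (starRingEnd ℂ) J) ρ (LineRing.isClosed_torusU_two (starRingEnd ℂ) J) μ₀) →
    ∀ {jc' : Finset {w : InfinitePlace L // IsComplex w} → {w : InfinitePlace L // IsComplex w} → Fin 3 → Fin 3 → ℂ},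
      (∀ a' : ↥(arch (↥(maximalRealSubfield L)) L (IsCMField.complexConj L) 3 (Matrix.diagonal α)) → ℂ, ArchSmooth L 3 (Matrix.diagonal α) a' → ArchHCSpaceG (slotSign L α) jc' (orbFamGExt L α ν' a')) →
    ∀ (S : Finset {w : InfinitePlace L // IsComplex w}) (w : {w : InfinitePlace L // IsComplex w}),
      (∀ w' ∈ S, w' ∈ splitChartPlaces L α) → IsCoveredWall (slotSign L α) S w →
        jc' S w 0 2 = I * C₁ / C₂ ∧ jc' S w 2 0 = -(I * C₁ / C₂) ∧ jc' S w 1 2 = -(I * C₁ / C₂) ∧ jc' S w 2 1 = I * C₁ / C₂ := by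
  intro L _ _ _ α _ _ ν' _ _ hherm hα J hJ _ _ _ _ _ _ μ₀ _ _ μ₀' _ _ C₁ C₂ hC₁ hC₂ hK0 hA0 hlink jc' hHC S w hS hcov
  -- ### frame facts
  have hreal : ∀ (w : {w : InfinitePlace L // IsComplex w}) (i : Fin 3), (w.1.embedding (α i)).im = 0 :=
    fun w i => im_embedding_diagonal_eq_zero L 3 α (complexConj_apply_eq_of_diagonal_frame hherm) w i
  have hw : w ∉ S := hcov.1
  have hwsp : w ∈ splitChartPlaces L α := mem_splitChartPlaces_of_isIndefiniteAt L α hα (hreal w) hcov.2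
  have hg02 : slotSign L α w 0 ≠ slotSign L α w 2 := slotSign_zero_ne_slotSign_two L α hα (hreal w) hcov.2
  have hs01 : slotSign L α w 0 = slotSign L α w 1 := (slotSign_of_mem_splitChartPlaces L α hα hwsp).1.symm
  have hg12 : slotSign L α w 1 ≠ slotSign L α w 2 := fun h => hg02 (hs01.trans h)
  have hsm : ∀ a' : ↥(arch (↥(maximalRealSubfield L)) L (IsCMField.complexConj L) 3 (Matrix.diagonal α)) → ℂ, ArchSmooth L 3 (Matrix.diagonal α) a' → ArchHcSmoothOneSided (slotSign L α) (orbFamGExt L α ν' a') :=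
    fun a' ha' => (hHC a' ha').2.2.1
  -- ### the (0,2) pin and the (2,0) pin, at one semiregular point `s`
  obtain ⟨s, hs⟩ := exists_hcSemireg_zero_two S hw
  obtain ⟨a₁, ha₁, hj₁, hne₁⟩ :=
    orbFamGExt_jumpGSideStatement_of_ne_zero L α ν' hherm hα hJ μ₀ μ₀' C₁ C₂ hC₁ hC₂ hK0 hA0 hlink S w s hS hcov hwsp hs hsm
  have hJ₁ : ArchHcJump (slotSign L α) jc' (orbFamGExt L α ν' a₁) := (hHC a₁ ha₁).2.2.2.2
  have h02 : jc' S w 0 2 = I * C₁ / C₂ := jc'_eq_of_hasOneSidedJump hJ₁ hw (by decide) hg02 hs hj₁ hne₁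
  have h20 : jc' S w 2 0 = -(I * C₁ / C₂) := by
    refine jc'_eq_of_hasOneSidedJump hJ₁ hw (by decide) hg02.symm hs.pair_swap ?_ ?_
    · have h := hasOneSidedJump_pair_swap (G := fun c => archERhoG S c * orbFamGExt L α ν' a₁ S c) (w := w) (i := 0) (j := 2) (p := s) hj₁
      rw [hcCayPt_swap]
      refine HasOneSidedJump.jump_congr h ?_
      ring
    · rw [hcCayPt_swap]; exact hne₁
  -- ### the (1,2) pin and the (2,1) pin, at the reflected point `p = σ s`
  have hp : HcSemireg S w 1 2 (hcSwapAt w 0 1 s) := hcSemireg_one_two_hcSwapAt_zero_one hw hs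
  obtain ⟨a₂, ha₂, hj₂, hne₂⟩ :=
    orbFamGExt_jumpGSideStatement_of_ne_zero L α ν' hherm hα hJ μ₀ μ₀' C₁ C₂ hC₁ hC₂ hK0 hA0 hlink S w (hcSwapAt w 0 1 (hcSwapAt w 0 1 s)) hS hcov hwsp
      (hp.hcSwapAt_zero_one hw) hsm
  have hJ₂ : ArchHcJump (slotSign L α) jc' (orbFamGExt L α ν' a₂) := (hHC a₂ ha₂).2.2.2.2
  have hW₂ : ArchHcWeyl (slotSign L α) (orbFamGExt L α ν' a₂) := archHcWeyl_orbFamGExt L α ν' hα hreal a₂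
  have hj₂' := hasOneSidedJump_wall_one_two_of_zero_two hW₂ hw hs01 hp hj₂
  have h12 : jc' S w 1 2 = -(I * C₁ / C₂) := by
    refine jc'_eq_of_hasOneSidedJump hJ₂ hw (by decide) hg12 hp ?_ ?_
    · rw [hcCayPt_one_two_eq_hcCayPt_zero_two_hcSwapAt]
      refine HasOneSidedJump.jump_congr hj₂' ?_
      ring
    · rw [hcCayPt_one_two_eq_hcCayPt_zero_two_hcSwapAt]; exact hne₂
  have h21 : jc' S w 2 1 = I * C₁ / C₂ := by
    refine jc'_eq_of_hasOneSidedJump hJ₂ hw (by decide) hg12.symm hp.pair_swap ?_ ?_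
    · have h := hasOneSidedJump_pair_swap (G := fun c => archERhoG S c * orbFamGExt L α ν' a₂ S c) (w := w) (i := 1) (j := 2) (p := hcSwapAt w 0 1 s) hj₂'
      rw [hcCayPt_swap, hcCayPt_one_two_eq_hcCayPt_zero_two_hcSwapAt]
      refine HasOneSidedJump.jump_congr h ?_
      ring
    · rw [hcCayPt_swap, hcCayPt_one_two_eq_hcCayPt_zero_two_hcSwapAt]; exact hne₂
  exact ⟨h02, h20, h12, h21⟩

/-! ## §3 Datum-free consequences: the internal symmetries of any valid jump datum -/

section OneFrame

variable (L : Type) [Field L] [NumberField L] [IsCMField L] (α : Fin 3 → L)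
  [MeasurableSpace ↥(arch (↥(maximalRealSubfield L)) L (IsCMField.complexConj L) 3 (Matrix.diagonal α))] [BorelSpace ↥(arch (↥(maximalRealSubfield L)) L (IsCMField.complexConj L) 3 (Matrix.diagonal α))]
  (ν' : Measure ↥(arch (↥(maximalRealSubfield L)) L (IsCMField.complexConj L) 3 (Matrix.diagonal α))) [ν'.IsHaarMeasure] [ν'.IsMulRightInvariant]

/-- **THE INTERNAL SYMMETRIES OF A VALID JUMP DATUM** (nondegenerate frame; the shared datum is obtained INSIDE the proof by ★ `sharedRankOneDatum_exists`): at every admissible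
chart `S` and covered place `w`, `jc′ S w 2 0 = −jc′ S w 0 2`, `jc′ S w 1 2 = −jc′ S w 0 2`, `jc′ S w 2 1 = jc′ S w 0 2`.
[cite: Shelstad1979, Prop. 4.5 (p. 26); Thm. 4.7 (IIIb) (p. 31)] [cite: Bouaziz1994IntegralesOrbitales, §3.2 (I₃) p. 580] -/
theorem archHcJump_const_table
    (hherm : ((Matrix.diagonal α).map (cmConjRingHom L)).transpose = Matrix.diagonal α) (hα : ∀ i, α i ≠ 0)
    {jc' : Finset {w : InfinitePlace L // IsComplex w} → {w : InfinitePlace L // IsComplex w} → Fin 3 → Fin 3 → ℂ}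
    (hHC : ∀ a' : ↥(arch (↥(maximalRealSubfield L)) L (IsCMField.complexConj L) 3 (Matrix.diagonal α)) → ℂ, ArchSmooth L 3 (Matrix.diagonal α) a' → ArchHCSpaceG (slotSign L α) jc' (orbFamGExt L α ν' a'))
    (S : Finset {w : InfinitePlace L // IsComplex w}) (w : {w : InfinitePlace L // IsComplex w})
    (hS : ∀ w' ∈ S, w' ∈ splitChartPlaces L α) (hcov : IsCoveredWall (slotSign L α) S w) :
    jc' S w 2 0 = -jc' S w 0 2 ∧ jc' S w 1 2 = -jc' S w 0 2 ∧ jc' S w 2 1 = jc' S w 0 2 := by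
  -- the standard rank-one carrier `U(J)` with its Borel structures, and the SHARED datum
  obtain ⟨J, hJ⟩ : ∃ J : Matrix (Fin 2) (Fin 2) ℂ, J = (StdForm.antidiagonal 2).over ℂ := ⟨_, rfl⟩
  letI : MeasurableSpace ↥(unitaryGroupOfForm (starRingEnd ℂ) J) := borel _
  haveI : BorelSpace ↥(unitaryGroupOfForm (starRingEnd ℂ) J) := ⟨rfl⟩
  haveI : LocallyCompactSpace ↥(unitaryGroupOfForm (starRingEnd ℂ) J) := locallyCompactSpace_unitaryGroupOfForm_complex J
  haveI : SecondCountableTopology ↥(unitaryGroupOfForm (starRingEnd ℂ) J) := secondCountableTopology_unitaryGroupOfForm_complex J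
  letI : MeasurableSpace (↥(unitaryGroupOfForm (starRingEnd ℂ) J) ⧸ torusU (starRingEnd ℂ) J) := borel _
  haveI : BorelSpace (↥(unitaryGroupOfForm (starRingEnd ℂ) J) ⧸ torusU (starRingEnd ℂ) J) := ⟨rfl⟩
  obtain ⟨μ₀, hμ₀H, hμ₀R, μ₀', hμ₀'i, hμ₀'f, C₁, C₂, hC₁, hC₂, hK0, hA0, hlink⟩ := sharedRankOneDatum_exists hJ
  haveI := hμ₀H
  haveI := hμ₀R
  haveI := hμ₀'i
  haveI := hμ₀'f
  obtain ⟨h02, h20, h12, h21⟩ :=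
    archHcJump_const_table_of_sharedDatum L α ν' hherm hα hJ μ₀ μ₀' C₁ C₂ hC₁ hC₂ hK0 hA0 hlink hHC S w hS hcov
  refine ⟨?_, ?_, ?_⟩
  · rw [h20, h02]
  · rw [h12, h02]
  · rw [h21, h02]

/-- **`jc′ S w i j = ε i j · jc′ S w 0 2` AT EVERY NONCOMPACT ORDERED PAIR** of a covered wall (`ε 0 2 = ε 2 1 = 1`, `ε 2 0 = ε 1 2 = −1` — the `ε`-table of ★
`archHcJump_orbFamGExt_of_wall02`; the guard `slotSign w i ≠ slotSign w j` leaves exactly these four pairs, ★ `noncompactPair_cases`).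
[cite: Shelstad1979, Prop. 4.5 (p. 26); Thm. 4.7 (IIIb) (p. 31)] [cite: Bouaziz1994IntegralesOrbitales, §3.2 (I₃) p. 580] -/
theorem archHcJump_const_eq_sign_mul
    (hherm : ((Matrix.diagonal α).map (cmConjRingHom L)).transpose = Matrix.diagonal α) (hα : ∀ i, α i ≠ 0)
    {jc' : Finset {w : InfinitePlace L // IsComplex w} → {w : InfinitePlace L // IsComplex w} → Fin 3 → Fin 3 → ℂ}
    (hHC : ∀ a' : ↥(arch (↥(maximalRealSubfield L)) L (IsCMField.complexConj L) 3 (Matrix.diagonal α)) → ℂ, ArchSmooth L 3 (Matrix.diagonal α) a' → ArchHCSpaceG (slotSign L α) jc' (orbFamGExt L α ν' a'))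
    (S : Finset {w : InfinitePlace L // IsComplex w}) (w : {w : InfinitePlace L // IsComplex w})
    (hS : ∀ w' ∈ S, w' ∈ splitChartPlaces L α) (hcov : IsCoveredWall (slotSign L α) S w)
    {i j : Fin 3} (hij : i ≠ j) (hsij : slotSign L α w i ≠ slotSign L α w j) :
    jc' S w i j = (if i = 0 ∧ j = 2 ∨ i = 2 ∧ j = 1 then 1 else if i = 2 ∧ j = 0 ∨ i = 1 ∧ j = 2 then -1 else 0 : ℂ) * jc' S w 0 2 := by
  have hreal : ∀ (w : {w : InfinitePlace L // IsComplex w}) (i : Fin 3), (w.1.embedding (α i)).im = 0 :=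
    fun w i => im_embedding_diagonal_eq_zero L 3 α (complexConj_apply_eq_of_diagonal_frame hherm) w i
  have hwsp : w ∈ splitChartPlaces L α := mem_splitChartPlaces_of_isIndefiniteAt L α hα (hreal w) hcov.2
  have hs01 : slotSign L α w 0 = slotSign L α w 1 := (slotSign_of_mem_splitChartPlaces L α hα hwsp).1.symm
  obtain ⟨h20, h12, h21⟩ := archHcJump_const_table L α ν' hherm hα hHC S w hS hcov
  rcases noncompactPair_cases hs01 hij hsij with ⟨rfl, rfl⟩ | ⟨rfl, rfl⟩ | ⟨rfl, rfl⟩ | ⟨rfl, rfl⟩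
  · rw [if_pos (by decide), one_mul]
  · rw [if_neg (by decide), if_pos (by decide), neg_one_mul, h20]
  · rw [if_neg (by decide), if_pos (by decide), neg_one_mul, h12]
  · rw [if_pos (by decide), one_mul, h21]

end OneFrame

/-! ## §4 Guards: the noncompact pairs of a split-chart place are the pairs meeting slot `2` — the same for every frame -/

section Guards

variable (L : Type) [Field L]

/-- **A split-chart place is INDEFINITE for the slot pattern** (converse of ★ `mem_splitChartPlaces_of_isIndefiniteAt`: `slotSign w 2 = −slotSign w 0 ≠ slotSign w 0`).
[cite: Rogawski1990, §3.6 p. 28; §14.2 p. 232] -/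
theorem isIndefiniteAt_of_mem_splitChartPlaces (α : Fin 3 → L) (hα : ∀ i, α i ≠ 0) {w : {w : InfinitePlace L // IsComplex w}}
    (hwsp : w ∈ splitChartPlaces L α) : IsIndefiniteAt (slotSign L α) w := by
  obtain ⟨h10, h20, h0⟩ := slotSign_of_mem_splitChartPlaces L α hα hwsp
  rintro ⟨h01, h12⟩
  apply h0
  have h : slotSign L α w 0 = -slotSign L α w 0 := by rw [← h20, ← h12, ← h01]
  generalize slotSign L α w 0 = t at h ⊢
  cases t <;> first | rfl | exact absurd h (by decide)

/-- **A compact place `w ∉ S` that is a split-chart place is a COVERED wall of the chart `S`** (★ `IsCoveredWall = (w ∉ S) ∧ IsIndefiniteAt`).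
[cite: Rogawski1990, §8.2 p. 119; §14.2 p. 232] -/
theorem isCoveredWall_of_mem_splitChartPlaces (α : Fin 3 → L) (hα : ∀ i, α i ≠ 0) {S : Finset {w : InfinitePlace L // IsComplex w}}
    {w : {w : InfinitePlace L // IsComplex w}} (hw : w ∉ S) (hwsp : w ∈ splitChartPlaces L α) : IsCoveredWall (slotSign L α) S w :=
  ⟨hw, isIndefiniteAt_of_mem_splitChartPlaces L α hα hwsp⟩

/-- **At a split-chart place of a nondegenerate frame the noncompact ordered pairs are exactly the pairs meeting the odd slot `2`** (`slotSign w 1 = slotSign w 0`,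
`slotSign w 2 = −slotSign w 0 ≠ 0`: ★ `slotSign_of_mem_splitChartPlaces`). [cite: Rogawski1990, §3.6 p. 28; §14.2 p. 232] [cite: Shelstad1979, §4 p. 23] -/
theorem slotSign_ne_iff_of_mem_splitChartPlaces (α : Fin 3 → L) (hα : ∀ i, α i ≠ 0) {w : {w : InfinitePlace L // IsComplex w}}
    (hwsp : w ∈ splitChartPlaces L α) (i j : Fin 3) :
    slotSign L α w i ≠ slotSign L α w j ↔ (i = 2 ∧ j ≠ 2) ∨ (i ≠ 2 ∧ j = 2) := by
  obtain ⟨h10, h20, h0⟩ := slotSign_of_mem_splitChartPlaces L α hα hwsp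
  have hne : slotSign L α w 0 ≠ -slotSign L α w 0 := by
    generalize slotSign L α w 0 = t at h0 ⊢
    cases t <;> simp_all
  fin_cases i <;> fin_cases j <;> simp [h10, h20, hne, hne.symm]

end Guards

/-! ## §5 The head: jump constants agree across the inner twist -/

section TwoFrames

variable (L : Type) [Field L] [NumberField L] [IsCMField L]
  (α₁ : Fin 3 → L)
  [MeasurableSpace ↥(arch (↥(maximalRealSubfield L)) L (IsCMField.complexConj L) 3 (Matrix.diagonal α₁))] [BorelSpace ↥(arch (↥(maximalRealSubfield L)) L (IsCMField.complexConj L) 3 (Matrix.diagonal α₁))]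
  (ν₁ : Measure ↥(arch (↥(maximalRealSubfield L)) L (IsCMField.complexConj L) 3 (Matrix.diagonal α₁))) [ν₁.IsHaarMeasure] [ν₁.IsMulRightInvariant]
  (α₂ : Fin 3 → L)
  [MeasurableSpace ↥(arch (↥(maximalRealSubfield L)) L (IsCMField.complexConj L) 3 (Matrix.diagonal α₂))] [BorelSpace ↥(arch (↥(maximalRealSubfield L)) L (IsCMField.complexConj L) 3 (Matrix.diagonal α₂))]
  (ν₂ : Measure ↥(arch (↥(maximalRealSubfield L)) L (IsCMField.complexConj L) 3 (Matrix.diagonal α₂))) [ν₂.IsHaarMeasure] [ν₂.IsMulRightInvariant]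

/-- **(5) «J′-TRANSPORT» — THE JUMP CONSTANTS OF TWO INNER FORMS AGREE.**  Two nondegenerate real diagonal frames `diag α₁`, `diag α₂` over the SAME CM field `L` (instance:
the anisotropic `α` of `G′_∞` and the isotropic quasi-split weights `β` of `G_∞ = U(Φ₃)_∞`), Haar measures `ν₁, ν₂`, jump data `jc₁, jc₂` each VALID FOR ALL TEST FUNCTIONS of its
group.  At every chart `S` admissible for both, place `w` covered for both and noncompact ordered pair `(i, j)`:  **`jc₁ S w i j = jc₂ S w i j`** — both are `ε i j · (i·C₁∕C₂)`
for ONE shared rank-one datum (§2), obtained once inside the proof; no Haar transport, no congruence of forms.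
[cite: Shelstad1979, §4 p. 20; Prop. 4.5 (p. 26); Thm. 4.7 (IIIb) (p. 31)] [cite: Bouaziz1994IntegralesOrbitales, §3.2 (I₃) p. 580]
[cite: Rogawski1990, §14.2 (14.2.1) pp. 232–233; §8.2 Prop. 8.2.1 (c) p. 119] -/
theorem archHcJump_const_eq_of_innerForms
    (hherm₁ : ((Matrix.diagonal α₁).map (cmConjRingHom L)).transpose = Matrix.diagonal α₁) (hα₁ : ∀ i, α₁ i ≠ 0)
    {jc₁ : Finset {w : InfinitePlace L // IsComplex w} → {w : InfinitePlace L // IsComplex w} → Fin 3 → Fin 3 → ℂ}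
    (hHC₁ : ∀ a : ↥(arch (↥(maximalRealSubfield L)) L (IsCMField.complexConj L) 3 (Matrix.diagonal α₁)) → ℂ,
      ArchSmooth L 3 (Matrix.diagonal α₁) a → ArchHCSpaceG (slotSign L α₁) jc₁ (orbFamGExt L α₁ ν₁ a))
    (hherm₂ : ((Matrix.diagonal α₂).map (cmConjRingHom L)).transpose = Matrix.diagonal α₂) (hα₂ : ∀ i, α₂ i ≠ 0)
    {jc₂ : Finset {w : InfinitePlace L // IsComplex w} → {w : InfinitePlace L // IsComplex w} → Fin 3 → Fin 3 → ℂ}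
    (hHC₂ : ∀ a : ↥(arch (↥(maximalRealSubfield L)) L (IsCMField.complexConj L) 3 (Matrix.diagonal α₂)) → ℂ,
      ArchSmooth L 3 (Matrix.diagonal α₂) a → ArchHCSpaceG (slotSign L α₂) jc₂ (orbFamGExt L α₂ ν₂ a))
    (S : Finset {w : InfinitePlace L // IsComplex w}) (w : {w : InfinitePlace L // IsComplex w})
    (hS₁ : ∀ w' ∈ S, w' ∈ splitChartPlaces L α₁) (hS₂ : ∀ w' ∈ S, w' ∈ splitChartPlaces L α₂)
    (hcov₁ : IsCoveredWall (slotSign L α₁) S w) (hcov₂ : IsCoveredWall (slotSign L α₂) S w)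
    {i j : Fin 3} (hij : i ≠ j) (hsij : slotSign L α₁ w i ≠ slotSign L α₁ w j) :
    jc₁ S w i j = jc₂ S w i j := by
  -- the standard rank-one carrier `U(J)` and ONE shared datum for both frames
  obtain ⟨J, hJ⟩ : ∃ J : Matrix (Fin 2) (Fin 2) ℂ, J = (StdForm.antidiagonal 2).over ℂ := ⟨_, rfl⟩
  letI : MeasurableSpace ↥(unitaryGroupOfForm (starRingEnd ℂ) J) := borel _
  haveI : BorelSpace ↥(unitaryGroupOfForm (starRingEnd ℂ) J) := ⟨rfl⟩
  haveI : LocallyCompactSpace ↥(unitaryGroupOfForm (starRingEnd ℂ) J) := locallyCompactSpace_unitaryGroupOfForm_complex J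
  haveI : SecondCountableTopology ↥(unitaryGroupOfForm (starRingEnd ℂ) J) := secondCountableTopology_unitaryGroupOfForm_complex J
  letI : MeasurableSpace (↥(unitaryGroupOfForm (starRingEnd ℂ) J) ⧸ torusU (starRingEnd ℂ) J) := borel _
  haveI : BorelSpace (↥(unitaryGroupOfForm (starRingEnd ℂ) J) ⧸ torusU (starRingEnd ℂ) J) := ⟨rfl⟩
  obtain ⟨μ₀, hμ₀H, hμ₀R, μ₀', hμ₀'i, hμ₀'f, C₁, C₂, hC₁, hC₂, hK0, hA0, hlink⟩ := sharedRankOneDatum_exists hJ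
  haveI := hμ₀H
  haveI := hμ₀R
  haveI := hμ₀'i
  haveI := hμ₀'f
  obtain ⟨a02, a20, a12, a21⟩ :=
    archHcJump_const_table_of_sharedDatum L α₁ ν₁ hherm₁ hα₁ hJ μ₀ μ₀' C₁ C₂ hC₁ hC₂ hK0 hA0 hlink hHC₁ S w hS₁ hcov₁
  obtain ⟨b02, b20, b12, b21⟩ :=
    archHcJump_const_table_of_sharedDatum L α₂ ν₂ hherm₂ hα₂ hJ μ₀ μ₀' C₁ C₂ hC₁ hC₂ hK0 hA0 hlink hHC₂ S w hS₂ hcov₂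
  -- the pair is one of the four noncompact ones
  have hreal₁ : ∀ (w : {w : InfinitePlace L // IsComplex w}) (i : Fin 3), (w.1.embedding (α₁ i)).im = 0 :=
    fun w i => im_embedding_diagonal_eq_zero L 3 α₁ (complexConj_apply_eq_of_diagonal_frame hherm₁) w i
  have hs01 : slotSign L α₁ w 0 = slotSign L α₁ w 1 :=
    (slotSign_of_mem_splitChartPlaces L α₁ hα₁ (mem_splitChartPlaces_of_isIndefiniteAt L α₁ hα₁ (hreal₁ w) hcov₁.2)).1.symm
  rcases noncompactPair_cases hs01 hij hsij with ⟨rfl, rfl⟩ | ⟨rfl, rfl⟩ | ⟨rfl, rfl⟩ | ⟨rfl, rfl⟩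
  · rw [a02, b02]
  · rw [a20, b20]
  · rw [a12, b12]
  · rw [a21, b21]

/-- **(5) «J′-TRANSPORT», `splitChartPlaces`-KEYED FORM** (the binder shape of the FORWARD brick (6) `archHCSpaceG_innerTransport_of_archHCSpaceG`'s `hjc`): the same
agreement with «covered» spelled `w ∉ S ∧ w ∈ splitChartPlaces L αₖ`. [cite: Shelstad1979, Thm. 4.7 (IIIb) (p. 31)] [cite: Bouaziz1994IntegralesOrbitales, §3.2 (I₃) p. 580]
[cite: Rogawski1990, §14.2 (14.2.1) pp. 232–233] -/
theorem archHcJump_const_eq_of_innerForms_of_mem_splitChartPlaces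
    (hherm₁ : ((Matrix.diagonal α₁).map (cmConjRingHom L)).transpose = Matrix.diagonal α₁) (hα₁ : ∀ i, α₁ i ≠ 0)
    {jc₁ : Finset {w : InfinitePlace L // IsComplex w} → {w : InfinitePlace L // IsComplex w} → Fin 3 → Fin 3 → ℂ}
    (hHC₁ : ∀ a : ↥(arch (↥(maximalRealSubfield L)) L (IsCMField.complexConj L) 3 (Matrix.diagonal α₁)) → ℂ,
      ArchSmooth L 3 (Matrix.diagonal α₁) a → ArchHCSpaceG (slotSign L α₁) jc₁ (orbFamGExt L α₁ ν₁ a))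
    (hherm₂ : ((Matrix.diagonal α₂).map (cmConjRingHom L)).transpose = Matrix.diagonal α₂) (hα₂ : ∀ i, α₂ i ≠ 0)
    {jc₂ : Finset {w : InfinitePlace L // IsComplex w} → {w : InfinitePlace L // IsComplex w} → Fin 3 → Fin 3 → ℂ}
    (hHC₂ : ∀ a : ↥(arch (↥(maximalRealSubfield L)) L (IsCMField.complexConj L) 3 (Matrix.diagonal α₂)) → ℂ,
      ArchSmooth L 3 (Matrix.diagonal α₂) a → ArchHCSpaceG (slotSign L α₂) jc₂ (orbFamGExt L α₂ ν₂ a))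
    (S : Finset {w : InfinitePlace L // IsComplex w}) (w : {w : InfinitePlace L // IsComplex w})
    (hS₁ : ∀ w' ∈ S, w' ∈ splitChartPlaces L α₁) (hS₂ : ∀ w' ∈ S, w' ∈ splitChartPlaces L α₂)
    (hw : w ∉ S) (hw₁ : w ∈ splitChartPlaces L α₁) (hw₂ : w ∈ splitChartPlaces L α₂)
    {i j : Fin 3} (hij : i ≠ j) (hsij : slotSign L α₁ w i ≠ slotSign L α₁ w j) :
    jc₁ S w i j = jc₂ S w i j :=
  archHcJump_const_eq_of_innerForms L α₁ ν₁ α₂ ν₂ hherm₁ hα₁ hHC₁ hherm₂ hα₂ hHC₂ S w hS₁ hS₂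
    (isCoveredWall_of_mem_splitChartPlaces L α₁ hα₁ hw hw₁) (isCoveredWall_of_mem_splitChartPlaces L α₂ hα₂ hw hw₂) hij hsij

/-- **(5) EXISTENCE FORM, for the FORWARD brick (6)**: given `jc₁` valid for all test functions on `U(diag α₁)_∞`, some `jc₂` valid for all test functions on `U(diag α₂)_∞`
(CUT B ★ `exists_jc_archHCSpaceG_orbFamGExt_of_ne_zero`) AGREES with `jc₁` at every chart admissible for both frames, place covered for both, noncompact pair (nothing is claimed
at `α₁`-definite places or on non-`α₁`-admissible charts: Cayley reading `0` there). [cite: Shelstad1979, Thm. 4.7 (IIIb) (p. 31)] [cite: Bouaziz1994IntegralesOrbitales, §3.2 (I₃) p. 580; Thm. 3.2.1 p. 581]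
[cite: Rogawski1990, §14.2 (14.2.1) pp. 232–233] -/
theorem exists_archHCSpaceG_const_eq_of_innerForms
    (hherm₁ : ((Matrix.diagonal α₁).map (cmConjRingHom L)).transpose = Matrix.diagonal α₁) (hα₁ : ∀ i, α₁ i ≠ 0)
    {jc₁ : Finset {w : InfinitePlace L // IsComplex w} → {w : InfinitePlace L // IsComplex w} → Fin 3 → Fin 3 → ℂ}
    (hHC₁ : ∀ a : ↥(arch (↥(maximalRealSubfield L)) L (IsCMField.complexConj L) 3 (Matrix.diagonal α₁)) → ℂ,
      ArchSmooth L 3 (Matrix.diagonal α₁) a → ArchHCSpaceG (slotSign L α₁) jc₁ (orbFamGExt L α₁ ν₁ a))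
    (hherm₂ : ((Matrix.diagonal α₂).map (cmConjRingHom L)).transpose = Matrix.diagonal α₂) (hα₂ : ∀ i, α₂ i ≠ 0) :
    ∃ jc₂ : Finset {w : InfinitePlace L // IsComplex w} → {w : InfinitePlace L // IsComplex w} → Fin 3 → Fin 3 → ℂ,
      (∀ a : ↥(arch (↥(maximalRealSubfield L)) L (IsCMField.complexConj L) 3 (Matrix.diagonal α₂)) → ℂ,
          ArchSmooth L 3 (Matrix.diagonal α₂) a → ArchHCSpaceG (slotSign L α₂) jc₂ (orbFamGExt L α₂ ν₂ a)) ∧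
        ∀ (S : Finset {w : InfinitePlace L // IsComplex w}) (w : {w : InfinitePlace L // IsComplex w}),
          (∀ w' ∈ S, w' ∈ splitChartPlaces L α₁) → (∀ w' ∈ S, w' ∈ splitChartPlaces L α₂) →
          IsCoveredWall (slotSign L α₁) S w → IsCoveredWall (slotSign L α₂) S w →
            ∀ i j : Fin 3, i ≠ j → slotSign L α₁ w i ≠ slotSign L α₁ w j → jc₂ S w i j = jc₁ S w i j := by
  obtain ⟨jc₂, hHC₂⟩ := exists_jc_archHCSpaceG_orbFamGExt_of_ne_zero L α₂ ν₂ hherm₂ hα₂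
  exact ⟨jc₂, hHC₂, fun S w hS₁ hS₂ hcov₁ hcov₂ i j hij hsij =>
    (archHcJump_const_eq_of_innerForms L α₁ ν₁ α₂ ν₂ hherm₁ hα₁ hHC₁ hherm₂ hα₂ hHC₂ S w hS₁ hS₂ hcov₁ hcov₂ hij hsij).symm⟩

end TwoFrames

end Literature.NumberTheory.Rogawski1990

end
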